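import Mathlib
import HarnessLib

/-!
# Combes–Thomas estimate for banded positive matrices (finite-dimensional, vector form)

The finite-dimensional core of "uniform bottom of a banded operator ⇒ exponential decay of its inverse kernel"
(Combes–Thomas 1973; Hislop–Sigal 1996, Ch. 19), in the vector form consumed by Helffer–Sjöstrand-type covariance
representations (`Cov(F,G) = ⟨∇F, (A¹)⁻¹ ∇G⟩` with `A¹` banded in a link index) and by Galerkin truncations:

* `sum_band_abs_mul_abs_le` — Schur test on a symmetric band: `∑_i ∑_{k ∈ N(i)} |w_i||w_k| ≤ z‖w‖²`;
* `combesThomas_banded` — if a real matrix `A` satisfies `⟨ω, Aω⟩ ≥ σ‖ω‖²`, is banded for a symmetric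
  pseudo-distance `d` (`A_{ik} = 0` when `d(i,k) > 1`), has off-diagonal entries `≤ h` in modulus and at most `z`
  neighbours per index, and `h z (e^μ − 1) ≤ σ/2`, then every solution of `A v = e_{k₀}` satisfies
  `|v_i| ≤ (2/σ) e^{−μ d(i,k₀)}`.

Proof: conjugate by the exponential weight `w_i = e^{μ d(i,k₀)} v_i`; the conjugation error is bounded by
`h z (e^μ − 1)‖w‖² ≤ (σ/2)‖w‖²` (Schur test on the band), so `(σ/2)‖w‖² ≤ ⟨w, e^{μd} A v⟩ = w_{k₀} ≤ ‖w‖`.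
Filed from crux stmt-QuantumFields-8761 (line `Sketch`, card `one-form-witten-ims`: `CombesThomasBanded`).

References: J. M. Combes, L. Thomas, Comm. Math. Phys. 34 (1973) 251–270; P. D. Hislop, I. M. Sigal,
*Introduction to Spectral Theory* (Springer 1996), Ch. 19.  Deliberately NOT here: the operator (infinite-dimensional,
resolvent) form and the Helffer–Sjöstrand identity itself.
-/

open scoped BigOperators
open Finset Matrix

namespace Literature.Analysis.OperatorTheory

variable {n : Type*} [Fintype n]

/-- Schur test on a symmetric band: `∑_{i} ∑_{k ∈ N(i)} |w_i| |w_k| ≤ z ‖w‖²` when every index has at most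
`z` neighbours and the neighbour relation is symmetric. [folklore] -/
theorem sum_band_abs_mul_abs_le (N : n → n → Prop) [DecidableRel N] (hsymm : ∀ i k, N i k → N k i)
    (z : ℝ) (hz : ∀ i, ((univ.filter fun k => N i k).card : ℝ) ≤ z) (w : n → ℝ) :
    ∑ i, ∑ k ∈ univ.filter (fun k => N i k), |w i| * |w k| ≤ z * ∑ i, w i ^ 2 := by
  -- AM–GM on each term, then count neighbours on both indices
  have h1 : ∑ i, ∑ k ∈ univ.filter (fun k => N i k), |w i| * |w k| ≤
      ∑ i, ∑ k ∈ univ.filter (fun k => N i k), (w i ^ 2 / 2 + w k ^ 2 / 2) := by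
    refine Finset.sum_le_sum fun i _ => Finset.sum_le_sum fun k _ => ?_
    nlinarith [sq_nonneg (|w i| - |w k|), sq_abs (w i), sq_abs (w k)]
  refine h1.trans ?_
  rw [show (∑ i, ∑ k ∈ univ.filter (fun k => N i k), (w i ^ 2 / 2 + w k ^ 2 / 2)) =
      (∑ i, ∑ k ∈ univ.filter (fun k => N i k), w i ^ 2 / 2) +
        ∑ i, ∑ k ∈ univ.filter (fun k => N i k), w k ^ 2 / 2 by
    rw [← Finset.sum_add_distrib]
    exact Finset.sum_congr rfl fun i _ => Finset.sum_add_distrib]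
  -- first double sum: `card N(i) * w_i²/2`
  have hA : ∑ i, ∑ k ∈ univ.filter (fun k => N i k), w i ^ 2 / 2 ≤ z / 2 * ∑ i, w i ^ 2 := by
    rw [Finset.mul_sum]
    refine Finset.sum_le_sum fun i _ => ?_
    rw [Finset.sum_const, nsmul_eq_mul]
    have := hz i
    nlinarith [sq_nonneg (w i)]
  -- second double sum: swap the order using symmetry of `N`
  have hB : ∑ i, ∑ k ∈ univ.filter (fun k => N i k), w k ^ 2 / 2 ≤ z / 2 * ∑ i, w i ^ 2 := by
    have hswap : ∑ i, ∑ k ∈ univ.filter (fun k => N i k), w k ^ 2 / 2 =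
        ∑ k, ∑ i ∈ univ.filter (fun i => N i k), w k ^ 2 / 2 := by
      rw [Finset.sum_comm']
      intro i k
      simp only [Finset.mem_filter, Finset.mem_univ, true_and]
      tauto
    rw [hswap, Finset.mul_sum]
    refine Finset.sum_le_sum fun k _ => ?_
    rw [Finset.sum_const, nsmul_eq_mul]
    have hcard : ((univ.filter fun i => N i k).card : ℝ) ≤ z := by
      have heq : (univ.filter fun i => N i k) = (univ.filter fun i => N k i) :=
        Finset.filter_congr fun i _ => ⟨hsymm i k, hsymm k i⟩
      rw [heq]; exact hz k
    nlinarith [sq_nonneg (w k)]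
  linarith

/-- **Combes–Thomas estimate for a banded positive matrix (vector form).**  Let `A` be a real matrix with
`⟨ω, Aω⟩ ≥ σ‖ω‖²` (`σ > 0`), banded for a symmetric pseudo-distance `d` (`d ≥ 0`, `d(i,i) = 0`, triangle
inequality; `A_{ik} = 0` whenever `d(i,k) > 1`), with off-diagonal entries bounded by `h ≥ 0` and at most `z`
indices `k ≠ i` with `d(i,k) ≤ 1` for every `i`.  If `μ ≥ 0` satisfies `h z (e^μ − 1) ≤ σ/2`, then every
solution `v` of `A v = e_{k₀}` decays exponentially away from `k₀`: `|v_i| ≤ (2/σ) e^{−μ d(i,k₀)}`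
(finite-dimensional banded form of the Combes–Thomas argument; cf. Hislop–Sigal 1996, Ch. 19). [cite: CombesThomas1973, §II] -/
theorem combesThomas_banded [DecidableEq n] (A : Matrix n n ℝ) (d : n → n → ℝ) (σ h z μ : ℝ)
    (hσ : 0 < σ) (hμ : 0 ≤ μ)
    (hd0 : ∀ i, d i i = 0) (hdsymm : ∀ i k, d i k = d k i) (hdtri : ∀ i j k, d i k ≤ d i j + d j k)
    (hband : ∀ i k, 1 < d i k → A i k = 0) (hh0 : 0 ≤ h) (hh : ∀ i k, i ≠ k → |A i k| ≤ h)
    (hz : ∀ i, ((univ.filter fun k => k ≠ i ∧ d i k ≤ 1).card : ℝ) ≤ z)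
    (hpos : ∀ ω : n → ℝ, σ * (ω ⬝ᵥ ω) ≤ ω ⬝ᵥ A.mulVec ω)
    (hsmall : h * z * (Real.exp μ - 1) ≤ σ / 2)
    (k₀ : n) (v : n → ℝ) (hv : A.mulVec v = Pi.single k₀ 1) (i : n) :
    |v i| ≤ 2 / σ * Real.exp (-(μ * d i k₀)) := by
  -- the exponentially weighted vector
  set φ : n → ℝ := fun j => d j k₀ with hφ
  set w : n → ℝ := fun j => Real.exp (μ * φ j) * v j with hw
  have hφlip : ∀ j k, |φ j - φ k| ≤ d j k := by
    intro j k
    rw [abs_sub_le_iff]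
    constructor
    · have := hdtri j k k₀; simp only [hφ]; linarith
    · have := hdtri k j k₀; rw [hdsymm k j] at this; simp only [hφ]; linarith
  -- key identity: ⟨w, E A v⟩ = w k₀, and E A v = E A E⁻¹ w
  have hEAv : ∀ j, Real.exp (μ * φ j) * (A.mulVec v) j = ∑ k, Real.exp (μ * (φ j - φ k)) * A j k * w k := by
    intro j
    simp only [mulVec, dotProduct, hw, Finset.mul_sum]
    refine Finset.sum_congr rfl fun k _ => ?_
    rw [mul_sub, Real.exp_sub]
    field_simp
  have hlhs : ∑ j, w j * (Real.exp (μ * φ j) * (A.mulVec v) j) = w k₀ := by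
    simp only [hv]
    rw [Finset.sum_eq_single k₀]
    · simp [hφ, hd0]
    · intro j _ hj; simp [hj]
    · intro h; exact absurd (Finset.mem_univ _) h
  -- split the conjugated form into ⟨w, A w⟩ + error
  have hsplit : ∑ j, w j * (Real.exp (μ * φ j) * (A.mulVec v) j) =
      w ⬝ᵥ A.mulVec w + ∑ j, ∑ k, (Real.exp (μ * (φ j - φ k)) - 1) * A j k * (w j * w k) := by
    have h0 : ∑ j, w j * (Real.exp (μ * φ j) * (A.mulVec v) j) =
        ∑ j, w j * ∑ k, Real.exp (μ * (φ j - φ k)) * A j k * w k :=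
      Finset.sum_congr rfl fun j _ => by rw [hEAv j]
    rw [h0]
    simp only [dotProduct, mulVec, Finset.mul_sum, ← Finset.sum_add_distrib]
    refine Finset.sum_congr rfl fun j _ => Finset.sum_congr rfl fun k _ => by ring
  -- bound the error by the Schur test on the band
  have herr : |∑ j, ∑ k, (Real.exp (μ * (φ j - φ k)) - 1) * A j k * (w j * w k)| ≤
      h * (Real.exp μ - 1) * (z * ∑ j, w j ^ 2) := by
    have hterm : ∀ j k, |(Real.exp (μ * (φ j - φ k)) - 1) * A j k * (w j * w k)| ≤
        h * (Real.exp μ - 1) * (if k ≠ j ∧ d j k ≤ 1 then |w j| * |w k| else 0) := by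
      intro j k
      by_cases hjk : k ≠ j ∧ d j k ≤ 1
      · rw [if_pos hjk, abs_mul, abs_mul, abs_mul]
        have h1 : |Real.exp (μ * (φ j - φ k)) - 1| ≤ Real.exp μ - 1 := by
          have hle : |μ * (φ j - φ k)| ≤ μ := by
            rw [abs_mul, abs_of_nonneg hμ]
            exact mul_le_of_le_one_right hμ ((hφlip j k).trans hjk.2)
          rw [abs_sub_le_iff]
          constructor
          · linarith [Real.exp_le_exp.2 (le_abs_self (μ * (φ j - φ k))), Real.exp_le_exp.2 hle]
          · have h3 : Real.exp (-μ) ≤ Real.exp (μ * (φ j - φ k)) :=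
              Real.exp_le_exp.2 (by linarith [neg_abs_le (μ * (φ j - φ k))])
            have h4 : 1 - Real.exp (-μ) ≤ Real.exp μ - 1 := by
              have h5 : Real.exp μ * Real.exp (-μ) = 1 := by rw [← Real.exp_add, add_neg_cancel, Real.exp_zero]
              nlinarith [Real.exp_pos μ, Real.exp_pos (-μ), Real.add_one_le_exp μ]
            linarith
        have h2 : |A j k| ≤ h := hh j k (Ne.symm hjk.1)
        have hh0 : 0 ≤ h := (abs_nonneg _).trans h2
        have he0 : 0 ≤ Real.exp μ - 1 := by linarith [Real.add_one_le_exp μ]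
        calc |Real.exp (μ * (φ j - φ k)) - 1| * |A j k| * (|w j| * |w k|)
            ≤ (Real.exp μ - 1) * h * (|w j| * |w k|) := by
              apply mul_le_mul_of_nonneg_right _ (by positivity)
              exact mul_le_mul h1 h2 (abs_nonneg _) he0
          _ = h * (Real.exp μ - 1) * (|w j| * |w k|) := by ring
      · rw [if_neg hjk]
        rw [not_and_or, not_not, not_le] at hjk
        rcases hjk with rfl | hlt
        · simp [hφ]
        · simp [hband j k hlt]
    calc |∑ j, ∑ k, (Real.exp (μ * (φ j - φ k)) - 1) * A j k * (w j * w k)|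
        ≤ ∑ j, ∑ k, |(Real.exp (μ * (φ j - φ k)) - 1) * A j k * (w j * w k)| :=
          (Finset.abs_sum_le_sum_abs _ _).trans (Finset.sum_le_sum fun j _ => Finset.abs_sum_le_sum_abs _ _)
      _ ≤ ∑ j, ∑ k, h * (Real.exp μ - 1) * (if k ≠ j ∧ d j k ≤ 1 then |w j| * |w k| else 0) :=
          Finset.sum_le_sum fun j _ => Finset.sum_le_sum fun k _ => hterm j k
      _ = h * (Real.exp μ - 1) * ∑ j, ∑ k ∈ univ.filter (fun k => k ≠ j ∧ d j k ≤ 1), |w j| * |w k| := by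
          rw [Finset.mul_sum]
          refine Finset.sum_congr rfl fun j _ => ?_
          rw [Finset.mul_sum, Finset.sum_filter]
          refine Finset.sum_congr rfl fun k _ => ?_
          split_ifs <;> simp
      _ ≤ h * (Real.exp μ - 1) * (z * ∑ j, w j ^ 2) := by
          have hh0' : 0 ≤ h * (Real.exp μ - 1) := mul_nonneg hh0 (by linarith [Real.add_one_le_exp μ])
          exact mul_le_mul_of_nonneg_left
            (sum_band_abs_mul_abs_le (fun j k => k ≠ j ∧ d j k ≤ 1)
              (fun j k hjk => ⟨Ne.symm hjk.1, by rw [hdsymm]; exact hjk.2⟩) z hz w) hh0'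
  -- assemble: (σ/2)‖w‖² ≤ w k₀ ≤ ‖w‖, hence ‖w‖ ≤ 2/σ and |w i| ≤ 2/σ
  set S : ℝ := ∑ j, w j ^ 2 with hS
  have hS0 : 0 ≤ S := Finset.sum_nonneg fun j _ => sq_nonneg _
  have hww : w ⬝ᵥ w = S := by simp only [dotProduct, hS]; exact Finset.sum_congr rfl fun j _ => by ring
  have hmain : σ / 2 * S ≤ w k₀ := by
    have h1 := hpos w
    rw [hww] at h1
    have h2 := (abs_le.1 herr).1
    have h3 : h * (Real.exp μ - 1) * (z * S) ≤ σ / 2 * S := by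
      have : h * (Real.exp μ - 1) * (z * S) = h * z * (Real.exp μ - 1) * S := by ring
      rw [this]; exact mul_le_mul_of_nonneg_right hsmall hS0
    linarith [hlhs, hsplit]
  have hk0 : w k₀ ^ 2 ≤ S := Finset.single_le_sum (f := fun j => w j ^ 2) (fun j _ => sq_nonneg _) (Finset.mem_univ k₀)
  have hi : w i ^ 2 ≤ S := Finset.single_le_sum (f := fun j => w j ^ 2) (fun j _ => sq_nonneg _) (Finset.mem_univ i)
  have hSle : S ≤ (2 / σ) ^ 2 := by
    by_cases hS' : S = 0
    · rw [hS']; positivity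
    · have hSpos : 0 < S := lt_of_le_of_ne hS0 (Ne.symm hS')
      have h1 : (σ / 2 * S) ^ 2 ≤ S := by
        have h0 : 0 ≤ σ / 2 * S := by positivity
        calc (σ / 2 * S) ^ 2 ≤ w k₀ ^ 2 := pow_le_pow_left₀ h0 hmain 2
          _ ≤ S := hk0
      have h2 : (σ / 2) ^ 2 * S ≤ 1 := by
        have : (σ / 2 * S) ^ 2 = (σ / 2) ^ 2 * S * S := by ring
        rw [this] at h1
        exact le_of_mul_le_mul_right (by linarith) hSpos
      rw [div_pow, le_div_iff₀ (by positivity)]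
      have : (σ / 2) ^ 2 = σ ^ 2 / 2 ^ 2 := by ring
      rw [this, div_mul_eq_mul_div, div_le_iff₀ (by positivity)] at h2
      linarith
  have hwi : |w i| ≤ 2 / σ := by
    have h1 : w i ^ 2 ≤ (2 / σ) ^ 2 := hi.trans hSle
    have h2 : 0 ≤ 2 / σ := by positivity
    exact abs_le_of_sq_le_sq' h1 h2 |> fun h => abs_le.2 h
  -- undo the weight
  have hvi : v i = Real.exp (-(μ * d i k₀)) * w i := by
    simp only [hw, hφ]
    rw [← mul_assoc, ← Real.exp_add, neg_add_cancel, Real.exp_zero, one_mul]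
  rw [hvi, abs_mul, Real.abs_exp, mul_comm]
  exact mul_le_mul_of_nonneg_right hwi (Real.exp_pos _).le

end Literature.Analysis.OperatorTheory
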